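import Summits.Schanuel.Schanuel.Theorems.RootDecomp1KTwoBaseCell09

/-!
# RootDecomp1KGapCell — lens 1, generation 42 «GAP CELL / INTERLACED SPECIALISATION» (lane K-R26 (α-loc)): the walls (1, ℓ_b, ρ), (1, ℓ₂, ℓ₃, ρ) (mod hNW), their π-twins and the 31077 pair (ℓ_b, ρ) HYPOTHESIS-FREE for every ρ ∈ `FactorialGapLiouville` — located order data strictly below the log-log floor; member ρ_W — part 1 (RootDecomp1KGapCell01): §0 helpers + §1 the class `FactorialGapLiouville`

PORT NOTE (census-1 gen 17, 2026-08-31): port of [HOME/decomp-schanuel-lens-1/g42/GapCell.lean EDITION 3 sha256 6f7828b1…, 2470 l (edition 1 3ca7b72e… 1995 l graded; edition 2 = + §10; edition 3 = proof-only engine reshape per census PORT HAND-BACK L1992 / VERDICT L2004 — statement diff ed1 ↔ ed3 EMPTY on all graded decls) + GCprobe + GCctrl + NODE-g42.md; CLAIM L1967, RULING L1970 (K-g42), NODE L1990 / REQUEST L1991, VERDICT L2004 (CLEARED — ONE CELL credit K-R26 (α-loc); lens-1 tally credits ×10 + THEOREM), EDITIONS 2+3 L2018/L2019, critic ACK L2023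 (bookkeeping continuation, PORT GO from edition 3)]; own farm rc 0 · 0 warn · 0 sorry · axioms std; import TREE `RootDecomp1KTwoBaseCell09` ONLY; the only def : Prop binder is the tree `NWMeasure` (hNW) on the e-walls.
Split in ten parts for the 400-line cap: 01 = §0 private tree-twin helpers + §1 the class `FactorialGapLiouville` (order + location of denominators only); 02 = §2a ENGINE PARTS (`sliceSet`, `blockSlice`, `slotCoeff`, `clearPoly`, `sliceSum`, `clearPoly_ne_zero_of_gap` = the gap step, `gap_balance_false` = the height/error balance); 03 = §2 THE GAP ENGINE `algebraicIndependent_gap_of_mvPolyMeasure` (`maxHeartbeats 800000 in` carried); 04 = §3 THE CELLS (`sb_gapPair` / `coordLiouvilleSchanuel_gapPair` HYPOTHESIS-FREE at 31077 n = 2, `sb_gapWall3/4` mod hNW, π-twins free) + §4 THE LIVE ITEMS in item shape (binders verbatim + ONE `Set.range` line) — filed `--supports stmt-Schanuel-31077` (the pair part; the walls ride with it); 05 = §5 THE MEMBER ρ_W (`factorialGapLiouville_rhoW`); 06 = §6 the members zG2/zG3/zG4 + π-twins with LI / LinLiouville / scope certificates; 07 = §7 `not_logLogLiouville_rhoW`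 (strictly below the log-log floor); 08 = §8 THREE INTERLACED SCALES `form_lower_bound_G`, `not_hyperLinLiouville_zG3/zG3pi`, `item33364_at_zG3`; 09 = §9 both location bounds load-bearing + ℓ_b² not gap-Liouville + §10 (ed.2) prefix; 10 = §10 `form_lower_bound_G4`, `not_hyperLinLiouville_zG4/zG4pi`, `finiteOrderLiouvilleSchanuel_at_zG4 (hNW)` / `_at_zG4pi`, `item33364_at_zG4`.
PORT EDITS: `set_option linter.dupNamespace false` dropped; 46 one-line docstrings (statement read-outs) added to undocumented helpers; `one_div_den_mul_den_le_abs_sub` made private (+ per-part copies) — statement-twin of the tree `RootDecomp1ELWTransport.one_div_le_abs_sub_rat` (dry-run dedup); statements and proofs verbatim; the LIVE `Iff.rfl` probes and the axiom guards stay in the HOME probe. Parts `--supports stmt-Schanuel-33364` except 04 (`--supports stmt-Schanuel-31077`); no census credit carried; nothing here proves Schanuel or the items; rung 0. The lens's header follows.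
-/

/-!
# RootDecomp1KGapCell — lens 1, generation 42 «THE GAP CELL: an order-data-only Liouville coordinate
# STRICTLY BELOW the log-log floor on the walls (1, ℓ₂, ρ) and (1, ℓ₂, ℓ₃, ρ)» (RULE K-R26 lane (α))
# EDITION 3 (= edition 2 with the engine PROOF reshaped into the context-free parts of §2a for the port's part cap —
# every STATEMENT of editions 1/2 unchanged; edition 2 = edition 1 of 13:28Z + §10: the wall-4 member `z_G` in 33364's scope)

MECHANISM (non-metric, «interlaced scales»).  The wall coordinate `ρ` is given by ORDER DATA ONLY — no
expansion, no radix, no measure of `ρ` — namely by the class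

  `FactorialGapLiouville ρ := ∀ A K, ∃ N ≥ K, ∃ r : ℚ, 2^{A·N!} < den r ∧ (den r)^A < 2^{(N+1)!} ∧ |ρ − r| < (den r)^{−A}`

(«`ρ` has rational approximations of every polynomial quality whose denominators sit in the GAPS
`(2^{A·N!}, 2^{(N+1)!/A})` of the factorial skeleton, for arbitrarily late `N`»).  ENGINE
(`algebraicIndependent_gap_of_mvPolyMeasure`): for bases `b_i ≥ 2` with injective monomial weights and any
tuple `θ⃗` with a polynomial measure of algebraic independence (`MvPolyMeasure θ`, tree), the tuple
`(ρ, ℓ_{b_1}, …, ℓ_{b_k}, θ⃗)` is algebraically independent over `ℚ`.  Proof: specialise the block at its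
truncations `s_{N,i} = p_i/b_i^{N!}` AND `ρ` at the gap approximant `r = a/q` SIMULTANEOUSLY; the cleared
`α₀`-slice `Σ_j a^j q^{d−j} κ_j` is a non-zero integer because (i) some `κ_j = D_ℓ · q_j(s_N) ≠ 0` by the tree's
lacunary lemma `eventually_eval_partialSum_ne_zero` and (ii) `q` exceeds every `|κ_j|` (the gap!), so the
tree's rational-root Lemma A `mvspecialise_ne_zero_of_coprime` applies; then `θ⃗`'s polynomial measure and the
Lipschitz bound give `1 ≤ 3A₀/q < 1`.  NO induced measure for `(ℓ₂, θ⃗)` is ever formed, so the log-log loss of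
the lineage's transfer engines does not occur: plain polynomial quality of `ρ` suffices — the price is paid in
the LOCATION of the approximants, not in their quality.

CONTENTS.  §0 helpers · §1 the class `FactorialGapLiouville` (+ `ne_rat`, `liouville`, the two-rationals lemma
`one_div_den_mul_den_le_abs_sub`) · §2 THE ENGINE (§2a ITS PARTS, edition 3: slice set, block slice, slot coefficients,
cleared polynomial `H`, `ρ`-slices `κ_j`, THE GAP step, threshold, gap arithmetic, balance) · §3 CELLS for the WHOLE CLASS: `algebraicIndependent_gapBlock`
(`(ρ, ℓ_{b⃗})` algebraically independent, HYP-FREE), `sb_gapPair` `(ℓ_b, ρ)` HYP-FREE (item 31077 at `n = 2`),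
`sb_gapWall3` `(1, ℓ_b, ρ)` and `sb_gapWall4` `(1, ℓ₂, ℓ₃, ρ)` mod `hNW` BY NAME, their π-twins HYP-FREE · §4 the
LIVE items 33364 / 31077 in item shape (binders VERBATIM + ONE `Set.range` line) · §5 THE MEMBER
`ρ_W = Σ_N 2^{−N!(⌊√N⌋+2)}`: `factorialGapLiouville_rhoW` (exact denominators `2^{c_N}`, odd numerators, tail
`≤ 2·2^{−c_{N+1}}`) · §6 the members `z_G'' = (ℓ₂, ρ_W)`, `z_G' = (1, ℓ₂, ρ_W)`, `z_G = (1, ℓ₂, ℓ₃, ρ_W)` and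
π-twins: ℚ-linear independence (from HYP-FREE algebraic independence), `LinLiouville`, the 31077 scope, `SB`, the
items APPLIED · §7 `ρ_W` is NOT log-log-Liouville, with the EFFECTIVE measure
`|ρ_W − p/q| ≥ exp(−12 · log q · log log q)` (`q ≥ 100`) — STRICTLY BELOW THE LOG-LOG FLOOR, hence (tree ladder)
not log-square / log-hyper / hyper-Liouville · §8 the three-scale form bound
`exp(−(1+Σ|gᵢ|)^17) ≤ |g₀ + g₁ℓ₂ + g₂ρ_W|` (HYP-FREE), so `z_G'` is IN THE SCOPE of 33364 (all three binders) and
33364 is DECIDED at `z_G'` (mod `hNW`) and at its π-twin (HYP-FREE) · §9 BOTH LOCATION BOUNDS ARE LOAD-BEARING: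
the one-sided mutations `GapLowerOnly` / `GapUpperOnly` each contain `ℓ_b²` (approximants `s_M²`, exact
denominators `b^{2M!}`), `(ℓ_b², ℓ_b)` is algebraically dependent, and `ℓ_b²` is PROVABLY NOT gap-Liouville
(`not_factorialGapLiouville_liouvilleNumber_sq`, refuted by the engine) — the class excludes the obstruction by theorem ·
§10 (EDITION 2) the FOUR-TERM TWO-RADIX form bound `exp(−(1+Σ|gᵢ|)^20) ≤ |g₀ + g₁ℓ₂ + g₂ℓ₃ + g₃ρ_W|` (HYP-FREE;
cuts `(N,N)`, `(N+1,N)`, `(N+1,N+1)` with `ℓ₂, ℓ₃` cut together, denominators `2^{max(K!, c_M)} 3^{K!}`), so the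
WALL-4 member `z_G = (1, ℓ₂, ℓ₃, ρ_W)` is IN THE SCOPE of 33364 (all three binders) and 33364 is DECIDED at `z_G`
(mod `hNW`) and at its π-twin (HYP-FREE).

Imports the TREE `RootDecomp1KTwoBaseCell09` only (transitively the LogLog / RelLiouville / Hyper chains);
no Theses import; no copy of a tree lemma except the primed one-line `private` helpers of §0 / §7
(re-proofs of private tree helpers `remainder_le`, `mvlen_*`, `exp_four_le`, `exp_one_le_four`, attributed) and
the `private` three-scale helpers of §8 / §10, which ADAPT (not copy) TwoBaseCell07's `form_approx` /
`form_scale_lower` / `form_two_scale` to the interlaced cuts (§10's `formG4_three_cut` re-uses the two-scale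
coprimality step verbatim in substance, attributed).  0 sorry · axioms standard.
-/

open Summit.Schanuel.Schanuel.Theorems.RootDecomp1KHyper
open Summit.Schanuel.Schanuel.Theorems.RootDecomp1KHyper.HyperCell
open Summit.Schanuel.Schanuel.Theorems.RootDecomp1KRelLiouvilleCell
open Summit.Schanuel.Schanuel.Theorems.RootDecomp1KLogLogCell
open Summit.Schanuel.Schanuel.Theorems.RootDecomp1KTwoBaseCell
open LiouvilleNumber
open scoped Nat

namespace Summit.Schanuel.Schanuel.Theorems.RootDecomp1KGapCell

/-! ## §0  Four private one-line helpers (re-proofs of `private` tree helpers of `RootDecomp1KTwoBaseCell04`) -/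

section Helpers
variable {n : ℕ}

/-- Upper bound for the tail in base `m ≥ 2`: `r_k ≤ 2·m^{-(k+1)!}` (tree twin: TwoBaseCell04 `remainder_le`). -/
private theorem remainder_le'' {m : ℝ} (hm : 2 ≤ m) (k : ℕ) : remainder m k ≤ 2 / m ^ (k + 1)! := by
  have m1 : (1 : ℝ) < m := by linarith
  have h := remainder_lt' k m1
  have hhalf : (1 : ℝ) / m ≤ 1 / 2 := one_div_le_one_div_of_le two_pos hm
  have hpos : (0 : ℝ) < 1 - 1 / m := by linarith
  have hinv : (1 - 1 / m)⁻¹ ≤ 2 := by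
    rw [inv_le_comm₀ hpos two_pos]
    linarith
  have hmk : (0 : ℝ) < 1 / m ^ (k + 1)! := by positivity
  calc remainder m k ≤ (1 - 1 / m)⁻¹ * (1 / m ^ (k + 1)!) := h.le
    _ ≤ 2 * (1 / m ^ (k + 1)!) := mul_le_mul_of_nonneg_right hinv hmk.le
    _ = 2 / m ^ (k + 1)! := by ring

/-- `mvlen (c·X^m) ≤ |c|` (tree twin). -/
private theorem mvlen_monomial_le'' (m : Fin n →₀ ℕ) (c : ℤ) :
    mvlen (MvPolynomial.monomial m c) ≤ |c| := by
  classical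
  rw [mvlen_eq_sum_of_support_subset _ MvPolynomial.support_monomial_subset, Finset.sum_singleton,
    MvPolynomial.coeff_monomial, if_pos rfl]

/-- Subadditivity of `mvlen` (tree twin). -/
private theorem mvlen_add_le'' (P Q : MvPolynomial (Fin n) ℤ) : mvlen (P + Q) ≤ mvlen P + mvlen Q := by
  classical
  have hs : (P + Q).support ⊆ P.support ∪ Q.support := MvPolynomial.support_add
  rw [mvlen_eq_sum_of_support_subset _ hs,
    mvlen_eq_sum_of_support_subset P (Finset.subset_union_left (s₂ := Q.support)),
    mvlen_eq_sum_of_support_subset Q (Finset.subset_union_right (s₁ := P.support)),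
    ← Finset.sum_add_distrib]
  exact Finset.sum_le_sum fun m _ => by rw [MvPolynomial.coeff_add]; exact abs_add_le _ _

/-- `mvlen (Σ F_i) ≤ Σ mvlen F_i` (tree twin). -/
private theorem mvlen_sum_le'' {ι : Type*} (s : Finset ι) (F : ι → MvPolynomial (Fin n) ℤ) :
    mvlen (∑ i ∈ s, F i) ≤ ∑ i ∈ s, mvlen (F i) := by
  classical
  induction s using Finset.induction_on with
  | empty => simp [mvlen]
  | insert a s ha ih =>
    rw [Finset.sum_insert ha, Finset.sum_insert ha]
    exact (mvlen_add_le'' _ _).trans (by linarith)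

end Helpers

/-! ## §1  The class: gap-Liouville reals (order data only) -/

section GapClass

/-- **Gap-Liouville reals.**  `ρ` is *factorial-gap-Liouville* if for every quality `A` and every threshold `K`
there is a scale `N ≥ K` and a rational `r` with `2^{A·N!} < den r`, `(den r)^A < 2^{(N+1)!}` and
`|ρ − r| < (den r)^{−A}`: good approximants whose denominators lie in the gaps of the factorial skeleton.
Pure order/location data — no expansion of `ρ` is involved. -/
def FactorialGapLiouville (ρ : ℝ) : Prop :=
  ∀ A K : ℕ, ∃ N : ℕ, K ≤ N ∧ ∃ r : ℚ, (2 : ℝ) ^ (A * N !) < r.den ∧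
    (r.den : ℝ) ^ A < (2 : ℝ) ^ (N + 1)! ∧ |ρ - r| < 1 / (r.den : ℝ) ^ A

/-- Two distinct rationals are `≥ 1/(den·den')` apart (as reals). -/
private theorem one_div_den_mul_den_le_abs_sub {s r : ℚ} (hne : s ≠ r) :
    1 / ((s.den : ℝ) * r.den) ≤ |(s : ℝ) - r| := by
  have hsd : (0 : ℝ) < s.den := by exact_mod_cast s.den_pos
  have hrd : (0 : ℝ) < r.den := by exact_mod_cast r.den_pos
  set z : ℤ := s.num * r.den - r.num * s.den with hz
  have hsub : (s : ℝ) - r = (z : ℝ) / ((s.den : ℝ) * r.den) := by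
    rw [Rat.cast_def s, Rat.cast_def r, hz]
    push_cast
    field_simp
  have hz0 : z ≠ 0 := by
    intro h0
    have : (s : ℝ) - r = 0 := by rw [hsub, h0]; simp
    exact hne (by exact_mod_cast (sub_eq_zero.mp this))
  have hz1 : (1 : ℝ) ≤ |(z : ℝ)| := by exact_mod_cast Int.one_le_abs hz0
  rw [hsub, abs_div, abs_of_pos (mul_pos hsd hrd)]
  exact div_le_div_of_nonneg_right hz1 (mul_pos hsd hrd).le

/-- A gap-Liouville real differs from every rational. -/
theorem FactorialGapLiouville.ne_rat {ρ : ℝ} (hρ : FactorialGapLiouville ρ) (s : ℚ) : ρ ≠ (s : ℝ) := by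
  intro hs
  obtain ⟨N, hN, r, h1, -, h3⟩ := hρ 2 s.den
  have hpow : ((N ! : ℕ) : ℝ) < (2 : ℝ) ^ (2 * N !) := by
    have h := Nat.lt_two_pow_self (n := 2 * N !)
    have : ((N ! : ℕ) : ℝ) ≤ ((2 * N ! : ℕ) : ℝ) := by exact_mod_cast Nat.le_mul_of_pos_left _ two_pos
    calc ((N ! : ℕ) : ℝ) ≤ ((2 * N ! : ℕ) : ℝ) := this
      _ < (2 : ℝ) ^ (2 * N !) := by exact_mod_cast h
  have hNfac : (s.den : ℝ) ≤ ((N ! : ℕ) : ℝ) := by exact_mod_cast hN.trans (Nat.self_le_factorial N)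
  have hsr : (s.den : ℝ) < r.den := by linarith
  have hne : s ≠ r := by
    intro h; rw [h] at hsr; exact lt_irrefl _ hsr
  have hrd : (0 : ℝ) < r.den := by exact_mod_cast r.den_pos
  have hlow := one_div_den_mul_den_le_abs_sub hne
  rw [hs] at h3
  have hup : 1 / (r.den : ℝ) ^ 2 ≤ 1 / ((s.den : ℝ) * r.den) := by
    rw [pow_two]
    exact one_div_le_one_div_of_le (by positivity) (mul_le_mul_of_nonneg_right hsr.le hrd.le)
  linarith

/-- A gap-Liouville real is a Liouville number (Mathlib's `Liouville`). -/
theorem FactorialGapLiouville.liouville {ρ : ℝ} (hρ : FactorialGapLiouville ρ) : Liouville ρ := by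
  intro m
  obtain ⟨N, -, r, h1, -, h3⟩ := hρ m 0
  have hden1 : (1 : ℝ) < r.den := by
    have h2 : (1 : ℝ) ≤ (2 : ℝ) ^ (m * N !) := one_le_pow₀ (by norm_num)
    linarith
  refine ⟨r.num, r.den, by exact_mod_cast hden1, ?_, ?_⟩
  · intro h
    refine FactorialGapLiouville.ne_rat hρ r ?_
    rw [h, Rat.cast_def]; push_cast; rfl
  · have e : ((r.num : ℤ) : ℝ) / (((r.den : ℕ) : ℤ) : ℝ) = (r : ℝ) := by
      rw [Rat.cast_def]; push_cast; rfl
    rw [e]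
    have e2 : (1 : ℝ) / (((r.den : ℕ) : ℤ) : ℝ) ^ m = 1 / (r.den : ℝ) ^ m := by push_cast; rfl
    rw [e2]; exact h3

end GapClass

end Summit.Schanuel.Schanuel.Theorems.RootDecomp1KGapCell
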